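import Literature.Probability.RandomPlanarGeometry.SAWAdsorptionFourLimits
import HarnessLib

/-!
# The four adsorption limits below `a = 1` (Janse van Rensburg–Whittington 2013, Lemma 1, desorbed side):
# lifted unfolded loops, `β(a) = μ` for `0 < a ≤ 1`

Topic `Literature/Probability/RandomPlanarGeometry` (continues `SAWAdsorptionFourLimits.lean`: for `a ≥ 1` the four sequences
`C_n(a)^{1/n}` (`Zd.adsZ`), `L_n(a)^{1/n}` (arches, `Zd.archZ`), `C‡_n(a)^{1/n}` (`Zd.unfZ`), `L‡_n(a)^{1/n}` (wall-returning
`x`-bridges, `AdsIrr.Bw`) converge to `e^{κ(a)}`).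

Janse van Rensburg–Whittington 2013, Lemma 1 (arXiv:1307.6457 p. 3; proof Hammersley–Torrie–Whittington 1982) states the
equality of the four limits for EVERY `a > 0`, «Also, `κ(a) = log μ_d` for `a ≤ 1`». For `0 < a ≤ 1` the upper bounds are the
tree's `Z⁺_n(a)^{1/n} → μ`; the lower bound is a LIFT: an unfolded loop `w` of length `n` becomes, after one step up, the
translated `w` (now one unit above the wall, no visits), one step east, one step down and one step east along the wall, an
unfolded loop of length `n + 4` with exactly two wall visits (`Zd.liftWord`, `Zd.liftWord_mem_wxbWords`, `Zd.visits_liftWord`),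
so `a² · B_n(1) ≤ B_{n+4}(a)` (`Zd.sq_mul_Bw_one_le_Bw`). Hence:

* `Zd.tendsto_Bw_rpow_of_le_one` — **`L‡_n(a)^{1/n} → μ` for `0 < a ≤ 1`** (so `β(a) = μ` there), and by the sandwich
  `L‡ ≤ L ≤ C`, `L‡ ≤ C‡ ≤ C`: `Zd.tendsto_archZ_rpow_of_le_one`, `Zd.tendsto_unfZ_rpow_of_le_one`;
* **`Zd.JansevanRensburgWhittington2013_lemma1_pos (ha : 0 < a)`** — the four limits coincide (`= Zd.adsRate a`) for
  every `a > 0` (d = 2): the printed Lemma 1 in full for the square lattice.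

Label: CONSOLIDATION (printed lemma, new kernel proof of the desorbed half by the lift). Pure standard axioms.
-/

noncomputable section

open Finset Filter Topology Literature.Probability.LatticeModels SimpleGraph
open scoped BigOperators

namespace Literature.Probability.RandomPlanarGeometry.SAW

/-- Reindexing inequality: an injection into a finset carrying nonnegative weights. [folklore] -/
private theorem sum_comp_le_sum_of_injOn'' {ι κ : Type*} [DecidableEq κ] {s : Finset ι} {t : Finset κ}
    (e : ι → κ) (he : Set.InjOn e s) (hst : ∀ x ∈ s, e x ∈ t) (g : κ → ℝ)
    (hg : ∀ y ∈ t, 0 ≤ g y) : ∑ x ∈ s, g (e x) ≤ ∑ y ∈ t, g y := by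
  rw [← Finset.sum_image (f := g) he]
  exact Finset.sum_le_sum_of_subset_of_nonneg (Finset.image_subset_iff.2 hst) fun b hb _ => hg b hb

namespace Zd

/-! ### The lift of an unfolded loop -/

/-- **The lift** of a word: one step up, the word, then east, down, east. [cite: JansevanRensburgWhittington2013, Lemma 1 (arXiv p. 3: «κ(a) = log μ_d for a ≤ 1»; proof attributed to HammersleyTorrieWhittington1982)] -/
def liftWord (w : List Step) : List Step := ((0 : Step) :: w) ++ [1, 2, 1]

/-- Length of the lift. [cite: JansevanRensburgWhittington2013, Lemma 1 (arXiv p. 3)] -/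
@[simp] theorem length_liftWord (w : List Step) : (liftWord w).length = w.length + 4 := by
  simp [liftWord]

/-- The lift is injective. [cite: JansevanRensburgWhittington2013, Lemma 1 (arXiv p. 3)] -/
theorem liftWord_injective : Function.Injective liftWord := by
  intro w w' h
  have h' : (0 : Step) :: w = (0 : Step) :: w' := List.append_cancel_right h
  exact (List.cons.inj h').2

/-- The three steps after the lifted copy: `e₁`, `e₁ - e₀`, `2e₁ - e₀`. [folklore] -/
private theorem traj_tail_values :
    traj [(1 : Step), 2, 1] 1 = ![0, 1] ∧ traj [(1 : Step), 2, 1] 2 = ![-1, 1] ∧ traj [(1 : Step), 2, 1] 3 = ![-1, 2] ∧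
      Step.vec 0 = ![1, 0] := by
  refine ⟨by decide, by decide, by decide, by decide⟩

/-- Positions of the lift during the lifted copy of `w`: `traj (lift w) (1 + j) = e₀ + traj w j` for `j ≤ |w|`. [folklore] -/
private theorem traj_liftWord_mid (w : List Step) {j : ℕ} (hj : j ≤ w.length) :
    traj (liftWord w) (1 + j) = Step.vec 0 + traj w j := by
  rw [liftWord, traj_append_left _ _ (by simp; omega), show (0 : Step) :: w = [0] ++ w from rfl,
    show 1 + j = [(0 : Step)].length + j by simp, traj_append_right]
  simp only [wEnd_singleton]

/-- Positions of the lift at the three final times. [folklore] -/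
private theorem traj_liftWord_tail (w : List Step) (i : ℕ) :
    traj (liftWord w) (w.length + 1 + i) = Step.vec 0 + wEnd w + traj [(1 : Step), 2, 1] i := by
  rw [liftWord, show w.length + 1 + i = ((0 : Step) :: w).length + i by simp, traj_append_right]
  simp only [wEnd_cons]

/-- **Coordinates along the lift.** For `1 ≤ i ≤ n+1`: height `1 + (height of w at i-1)`, wall coordinate that of `w`;
then `(1, X+1)`, `(0, X+1)`, `(0, X+2)` with `X = x₁(end of w)`. [folklore] -/
private theorem liftWord_coords {n : ℕ} {w : List Step} (hl : w.length = n) (hend : wEnd w 0 = 0) :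
    (∀ i, 1 ≤ i → i ≤ n + 1 → traj (liftWord w) i 0 = 1 + traj w (i - 1) 0 ∧ traj (liftWord w) i 1 = traj w (i - 1) 1) ∧
    traj (liftWord w) (n + 2) 0 = 1 ∧ traj (liftWord w) (n + 2) 1 = wEnd w 1 + 1 ∧
    traj (liftWord w) (n + 3) 0 = 0 ∧ traj (liftWord w) (n + 3) 1 = wEnd w 1 + 1 ∧
    traj (liftWord w) (n + 4) 0 = 0 ∧ traj (liftWord w) (n + 4) 1 = wEnd w 1 + 2 := by
  obtain ⟨t1, t2, t3, v0⟩ := traj_tail_values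
  have hA : ∀ i, traj (liftWord w) (n + 1 + i) = Step.vec 0 + wEnd w + traj [(1 : Step), 2, 1] i := fun i => by
    rw [← hl]; exact traj_liftWord_tail w i
  refine ⟨fun i hi1 hi2 => ?_, ?_, ?_, ?_, ?_, ?_, ?_⟩
  · have h := traj_liftWord_mid w (j := i - 1) (by omega)
    rw [show 1 + (i - 1) = i by omega] at h
    rw [h, v0]
    constructor
    · simp only [Pi.add_apply, Matrix.cons_val_zero]
    · simp only [Pi.add_apply, Matrix.cons_val_one, Matrix.cons_val_zero, zero_add]
  · rw [show n + 2 = n + 1 + 1 by omega, hA 1, t1, v0]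
    simp only [Pi.add_apply, Matrix.cons_val_zero]; omega
  · rw [show n + 2 = n + 1 + 1 by omega, hA 1, t1, v0]
    simp only [Pi.add_apply, Matrix.cons_val_one, Matrix.cons_val_zero]; omega
  · rw [show n + 3 = n + 1 + 2 by omega, hA 2, t2, v0]
    simp only [Pi.add_apply, Matrix.cons_val_zero]; omega
  · rw [show n + 3 = n + 1 + 2 by omega, hA 2, t2, v0]
    simp only [Pi.add_apply, Matrix.cons_val_one, Matrix.cons_val_zero]; omega
  · rw [show n + 4 = n + 1 + 3 by omega, hA 3, t3, v0]
    simp only [Pi.add_apply, Matrix.cons_val_zero]; omega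
  · rw [show n + 4 = n + 1 + 3 by omega, hA 3, t3, v0]
    simp only [Pi.add_apply, Matrix.cons_val_one, Matrix.cons_val_zero]; omega

/-- **The lift of an unfolded loop of length `n` is an unfolded loop of length `n + 4`.**
[cite: JansevanRensburgWhittington2013, Lemma 1 (arXiv p. 3); proof attributed to HammersleyTorrieWhittington1982] -/
theorem liftWord_mem_wxbWords {n : ℕ} {w : List Step} (hw : w ∈ AdsIrr.wxbWords n) :
    liftWord w ∈ AdsIrr.wxbWords (n + 4) := by
  obtain ⟨hl, hS, hpos, hend, hx0, hx⟩ := AdsIrr.mem_wxbWords.1 hw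
  obtain ⟨hmid, h20, h21, h30, h31, h40, h41⟩ := liftWord_coords hl hend
  have hinj : Set.InjOn (traj w) {i | i ≤ w.length} := (isSAW_iff_injOn w).1 hS
  have hX0 : 0 ≤ wEnd w 1 := by have := hx0 w.length le_rfl; rwa [traj_length] at this
  have hxle : ∀ j ≤ n, traj w j 1 ≤ wEnd w 1 := fun j hj => by
    rcases (hl ▸ hj : j ≤ w.length).lt_or_eq with h | h
    · exact (hx j h).le
    · rw [h, traj_length]
  have hE : wEnd (liftWord w) = traj (liftWord w) (n + 4) := by
    rw [← traj_length, length_liftWord, hl]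
  have hposL : ∀ i, 1 ≤ i → i ≤ n + 2 → 1 ≤ traj (liftWord w) i 0 := by
    intro i hi1 hi2
    rcases Nat.lt_or_ge i (n + 2) with h | h
    · rw [(hmid i hi1 (by omega)).1]; have := hpos (i - 1) (by rw [hl]; omega); omega
    · rw [show i = n + 2 by omega, h20]
  have hx1L : ∀ i ≤ n + 1, traj (liftWord w) i 1 ≤ wEnd w 1 := by
    intro i hi
    rcases Nat.eq_zero_or_pos i with rfl | hpos'
    · rw [traj_zero]; simpa using hX0
    · rw [(hmid i hpos' hi).2]; exact hxle (i - 1) (by omega)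
  have key : ∀ i i', i < i' → i' ≤ n + 4 → traj (liftWord w) i ≠ traj (liftWord w) i' := by
    intro i i' hlt hi' heq
    have e0 := congrFun heq 0
    have e1 := congrFun heq 1
    rcases Nat.lt_or_ge i' (n + 2) with h1 | h1
    · rcases Nat.eq_zero_or_pos i with rfl | hi0
      · rw [traj_zero] at e0; have := hposL i' (by omega) (by omega); simp at e0; omega
      · have ew : traj w (i - 1) = traj w (i' - 1) := by
          have h := heq
          have a1 := traj_liftWord_mid w (j := i - 1) (by rw [hl]; omega)
          have a2 := traj_liftWord_mid w (j := i' - 1) (by rw [hl]; omega)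
          rw [show 1 + (i - 1) = i by omega] at a1
          rw [show 1 + (i' - 1) = i' by omega] at a2
          rw [a1, a2] at h
          exact add_left_cancel h
        have := hinj (show i - 1 ∈ {i | i ≤ w.length} by simp; omega)
          (show i' - 1 ∈ {i | i ≤ w.length} by simp; omega) ew
        omega
    · rcases Nat.lt_or_ge i' (n + 3) with h2 | h2
      · rw [show i' = n + 2 by omega, h21] at e1
        have := hx1L i (by omega); omega
      · rcases Nat.lt_or_ge i' (n + 4) with h3 | h3
        · have hi3 : i' = n + 3 := by omega
          rw [hi3] at e0 e1
          rcases Nat.eq_zero_or_pos i with rfl | hi0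
          · rw [traj_zero, h31] at e1; simp at e1; omega
          · rw [h30] at e0; have := hposL i hi0 (by omega); omega
        · have hi4 : i' = n + 4 := by omega
          rw [hi4] at e0 e1
          rcases Nat.eq_zero_or_pos i with rfl | hi0
          · rw [traj_zero, h41] at e1; simp at e1; omega
          · rcases Nat.lt_or_ge i (n + 3) with h5 | h5
            · rw [h40] at e0; have := hposL i hi0 (by omega); omega
            · rw [show i = n + 3 by omega, h31, h41] at e1; omega
  refine AdsIrr.mem_wxbWords.2 ⟨by rw [length_liftWord, hl], ?_, fun i hi => ?_, by rw [hE, h40], fun i hi => ?_,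
    fun i hi => ?_⟩
  · rw [isSAW_iff_injOn, length_liftWord, hl]
    intro i hi i' hi' heq
    simp only [Set.mem_setOf_eq] at hi hi'
    rcases lt_trichotomy i i' with h | h | h
    · exact absurd heq (key i i' h hi')
    · exact h
    · exact absurd heq.symm (key i' i h hi)
  · rw [length_liftWord, hl] at hi
    rcases Nat.eq_zero_or_pos i with rfl | hi0
    · simp
    · rcases Nat.lt_or_ge i (n + 3) with h | h
      · have := hposL i hi0 (by omega); omega
      · rcases Nat.lt_or_ge i (n + 4) with h' | h'
        · rw [show i = n + 3 by omega, h30]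
        · rw [show i = n + 4 by omega, h40]
  · rw [length_liftWord, hl] at hi
    rcases Nat.lt_or_ge i (n + 2) with h | h
    · rcases Nat.eq_zero_or_pos i with rfl | hi0
      · simp
      · rw [(hmid i hi0 (by omega)).2]; exact hx0 (i - 1) (by rw [hl]; omega)
    · rcases Nat.lt_or_ge i (n + 3) with h' | h'
      · rw [show i = n + 2 by omega, h21]; omega
      · rcases Nat.lt_or_ge i (n + 4) with h'' | h''
        · rw [show i = n + 3 by omega, h31]; omega
        · rw [show i = n + 4 by omega, h41]; omega
  · rw [length_liftWord, hl] at hi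
    rw [hE, h41]
    rcases Nat.lt_or_ge i (n + 2) with h | h
    · have := hx1L i (by omega); omega
    · rcases Nat.lt_or_ge i (n + 3) with h' | h'
      · rw [show i = n + 2 by omega, h21]; omega
      · rw [show i = n + 3 by omega, h31]; omega

/-- **The lift has exactly two wall visits** (the two final vertices). [cite: JansevanRensburgWhittington2013, Lemma 1 (arXiv p. 3)] -/
theorem visits_liftWord {n : ℕ} {w : List Step} (hw : w ∈ AdsIrr.wxbWords n) : AdsIrr.visits (liftWord w) = 2 := by
  obtain ⟨hl, -, hpos, hend, -, -⟩ := AdsIrr.mem_wxbWords.1 hw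
  obtain ⟨hmid, h20, -, h30, -, h40, -⟩ := liftWord_coords hl hend
  unfold AdsIrr.visits
  rw [length_liftWord, hl, Finset.sum_range_succ, Finset.sum_range_succ, show n + 2 + 1 = n + 3 by omega,
    show n + 3 + 1 = n + 4 by omega, if_pos h30, if_pos h40]
  rw [Finset.sum_eq_zero fun j hj => ?_]
  rw [Finset.mem_range] at hj
  rw [if_neg]
  rcases Nat.lt_or_ge j (n + 1) with h | h
  · rw [(hmid (j + 1) (by omega) (by omega)).1, Nat.add_sub_cancel]; have := hpos j (by rw [hl]; omega); omega
  · rw [show j + 1 = n + 2 by omega, h20]; norm_num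

/-- **`a² · B_n(1) ≤ B_{n+4}(a)`** (`a ≥ 0`): the lifts of the unfolded loops of length `n`.
[cite: JansevanRensburgWhittington2013, Lemma 1 (arXiv p. 3: «κ(a) = log μ_d for a ≤ 1»); proof attributed to HammersleyTorrieWhittington1982] -/
theorem sq_mul_Bw_one_le_Bw (n : ℕ) {a : ℝ} (ha : 0 ≤ a) : a ^ 2 * AdsIrr.Bw n 1 ≤ AdsIrr.Bw (n + 4) a := by
  classical
  unfold AdsIrr.Bw
  simp only [one_pow, Finset.sum_const, nsmul_eq_mul, mul_one]
  rw [mul_comm, ← nsmul_eq_mul, ← Finset.sum_const]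
  have heq : ∀ w ∈ AdsIrr.wxbWords n, a ^ 2 = a ^ AdsIrr.visits (liftWord w) := fun w hw => by rw [visits_liftWord hw]
  rw [Finset.sum_congr rfl heq]
  exact sum_comp_le_sum_of_injOn'' liftWord (fun _ _ _ _ h => liftWord_injective h) (fun w hw => liftWord_mem_wxbWords hw)
    (fun w => a ^ AdsIrr.visits w) (fun _ _ => pow_nonneg ha _)

/-! ### The limits for `0 < a ≤ 1` -/

/-- `B_n(1)^{1/n} → μ` (the case `a = 1` of the four limits). [cite: JansevanRensburgWhittington2013, Lemma 1 (arXiv p. 3)] -/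
theorem tendsto_Bw_one_rpow : Tendsto (fun n : ℕ => (AdsIrr.Bw n 1) ^ (1 / (n : ℝ))) atTop (𝓝 (connectiveConstant 2)) := by
  have h := (JansevanRensburgWhittington2013_lemma1 le_rfl).2.2.2
  rwa [adsRate_eq_connectiveConstant zero_le_one le_rfl] at h

/-- **`L‡_n(a)^{1/n} → μ` for `0 < a ≤ 1`**, i.e. `β(a) = μ` in the desorbed phase.
[cite: JansevanRensburgWhittington2013, Lemma 1 (arXiv p. 3: «lim n⁻¹ log L‡_n(a) = κ(a)» and «κ(a) = log μ_d for a ≤ 1»); proof attributed to HammersleyTorrieWhittington1982] -/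
theorem tendsto_Bw_rpow_of_le_one {a : ℝ} (ha0 : 0 < a) (ha1 : a ≤ 1) :
    Tendsto (fun n : ℕ => (AdsIrr.Bw n a) ^ (1 / (n : ℝ))) atTop (𝓝 (connectiveConstant 2)) := by
  set μ := connectiveConstant 2 with hμdef
  have hμ : 0 < μ := connectiveConstant_pos 2
  -- it suffices to treat the shifted sequence `n ↦ n + 4`
  rw [← tendsto_add_atTop_iff_nat 4]
  -- upper bound: `B ≤ Z⁺`, `Z⁺_m(a)^{1/m} → μ`
  have hup : Tendsto (fun n : ℕ => (adsZ (n + 4) a) ^ (1 / ((n + 4 : ℕ) : ℝ))) atTop (𝓝 μ) :=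
    (tendsto_adsZ_rpow_of_le_one ha0.le ha1).comp (tendsto_add_atTop_nat 4)
  -- lower bound: `(a² B_n(1))^{1/(n+4)} → μ`
  have hlow : Tendsto (fun n : ℕ => (a ^ 2 * AdsIrr.Bw n 1) ^ (1 / ((n + 4 : ℕ) : ℝ))) atTop (𝓝 μ) := by
    -- `(a²)^{1/(n+4)} → 1`
    have hexp0 : Tendsto (fun n : ℕ => (1 : ℝ) / ((n + 4 : ℕ) : ℝ)) atTop (𝓝 0) :=
      tendsto_const_nhds.div_atTop (tendsto_natCast_atTop_atTop.comp (tendsto_add_atTop_nat 4))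
    have h1 : Tendsto (fun n : ℕ => (a ^ 2) ^ (1 / ((n + 4 : ℕ) : ℝ))) atTop (𝓝 1) := by
      have h := tendsto_const_nhds.rpow hexp0 (Or.inl (pow_pos ha0 2).ne') (f := fun _ : ℕ => a ^ 2)
      rwa [Real.rpow_zero] at h
    -- `B_n(1)^{1/(n+4)} = (B_n(1)^{1/n})^{n/(n+4)} → μ^1`
    have hq : Tendsto (fun n : ℕ => (n : ℝ) / ((n + 4 : ℕ) : ℝ)) atTop (𝓝 1) := by
      have h := tendsto_natCast_div_add_atTop (4 : ℝ)
      refine h.congr' (Eventually.of_forall fun n => ?_)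
      push_cast; rfl
    have h2 : Tendsto (fun n : ℕ => ((AdsIrr.Bw n 1) ^ (1 / (n : ℝ))) ^ ((n : ℝ) / ((n + 4 : ℕ) : ℝ))) atTop (𝓝 μ) := by
      have h := tendsto_Bw_one_rpow.rpow hq (Or.inl hμ.ne')
      rwa [Real.rpow_one] at h
    have h2' : Tendsto (fun n : ℕ => (AdsIrr.Bw n 1) ^ (1 / ((n + 4 : ℕ) : ℝ))) atTop (𝓝 μ) := by
      refine h2.congr' ?_
      filter_upwards [eventually_ge_atTop 1] with n hn
      rw [← Real.rpow_mul (AdsIrr.Bw_nonneg n zero_le_one)]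
      congr 1
      have hn0 : (n : ℝ) ≠ 0 := by exact_mod_cast (show n ≠ 0 by omega)
      field_simp
    have h12 := h1.mul h2'
    rw [one_mul] at h12
    refine h12.congr' (Eventually.of_forall fun n => ?_)
    exact (Real.mul_rpow (pow_nonneg ha0.le 2) (AdsIrr.Bw_nonneg n zero_le_one)).symm
  refine tendsto_of_tendsto_of_tendsto_of_le_of_le hlow hup (fun n => ?_) (fun n => ?_)
  · exact Real.rpow_le_rpow (mul_nonneg (pow_nonneg ha0.le 2) (AdsIrr.Bw_nonneg n zero_le_one))
      (sq_mul_Bw_one_le_Bw n ha0.le) (by positivity)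
  · exact Real.rpow_le_rpow (AdsIrr.Bw_nonneg _ ha0.le) (AdsIrr.Bw_le_adsZ _ ha0.le) (by positivity)

/-- **`L_n(a)^{1/n} → μ` for `0 < a ≤ 1`** (loops, squeezed between `L‡` and `C`). [cite: JansevanRensburgWhittington2013, Lemma 1 (arXiv p. 3: «lim n⁻¹ log L_n(a) = κ(a)»)] -/
theorem tendsto_archZ_rpow_of_le_one {a : ℝ} (ha0 : 0 < a) (ha1 : a ≤ 1) :
    Tendsto (fun n : ℕ => (archZ n a) ^ (1 / (n : ℝ))) atTop (𝓝 (connectiveConstant 2)) := by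
  refine tendsto_of_tendsto_of_tendsto_of_le_of_le (tendsto_Bw_rpow_of_le_one ha0 ha1)
    (tendsto_adsZ_rpow_of_le_one ha0.le ha1) (fun n => ?_) (fun n => ?_)
  · exact Real.rpow_le_rpow (AdsIrr.Bw_nonneg n ha0.le) (Bw_le_archZ n ha0.le) (by positivity)
  · exact Real.rpow_le_rpow (archZ_nonneg n ha0.le) (archZ_le_adsZ n ha0.le) (by positivity)

/-- **`C‡_n(a)^{1/n} → μ` for `0 < a ≤ 1`** (unfolded walks). [cite: JansevanRensburgWhittington2013, Lemma 1 (arXiv p. 3: «lim n⁻¹ log C‡_n(a) = κ(a)»)] -/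
theorem tendsto_unfZ_rpow_of_le_one {a : ℝ} (ha0 : 0 < a) (ha1 : a ≤ 1) :
    Tendsto (fun n : ℕ => (unfZ n a) ^ (1 / (n : ℝ))) atTop (𝓝 (connectiveConstant 2)) := by
  refine tendsto_of_tendsto_of_tendsto_of_le_of_le (tendsto_Bw_rpow_of_le_one ha0 ha1)
    (tendsto_adsZ_rpow_of_le_one ha0.le ha1) (fun n => ?_) (fun n => ?_)
  · exact Real.rpow_le_rpow (AdsIrr.Bw_nonneg n ha0.le) (Bw_le_unfZ n ha0.le) (by positivity)
  · exact Real.rpow_le_rpow (unfZ_nonneg n ha0.le) (unfZ_le_adsZ n ha0.le) (by positivity)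

/-- **Janse van Rensburg–Whittington 2013, Lemma 1 (Hammersley–Torrie–Whittington 1982), `d = 2`, every `a > 0`: the four
limits exist and are equal** (`= e^{κ(a)} = Zd.adsRate a`; for `a ≤ 1` all four equal `μ`).
[cite: JansevanRensburgWhittington2013, Lemma 1 (arXiv p. 3: «For unfolding in the x-direction and a > 0 the following limits exist and are equal … ≡ κ(a). Also, κ(a) = log μ_d for a ≤ 1.»; proof attributed to HammersleyTorrieWhittington1982)] -/
theorem JansevanRensburgWhittington2013_lemma1_pos {a : ℝ} (ha : 0 < a) :
    Tendsto (fun n : ℕ => (adsZ n a) ^ (1 / (n : ℝ))) atTop (𝓝 (adsRate a)) ∧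
    Tendsto (fun n : ℕ => (archZ n a) ^ (1 / (n : ℝ))) atTop (𝓝 (adsRate a)) ∧
    Tendsto (fun n : ℕ => (unfZ n a) ^ (1 / (n : ℝ))) atTop (𝓝 (adsRate a)) ∧
    Tendsto (fun n : ℕ => (AdsIrr.Bw n a) ^ (1 / (n : ℝ))) atTop (𝓝 (adsRate a)) := by
  rcases le_total a 1 with h1 | h1
  · rw [adsRate_eq_connectiveConstant ha.le h1]
    exact ⟨tendsto_adsZ_rpow_of_le_one ha.le h1, tendsto_archZ_rpow_of_le_one ha h1,
      tendsto_unfZ_rpow_of_le_one ha h1, tendsto_Bw_rpow_of_le_one ha h1⟩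
  · exact JansevanRensburgWhittington2013_lemma1 h1

end Zd

end Literature.Probability.RandomPlanarGeometry.SAW
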